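import Literature.NumberTheory.LFunctions.KloostermanQuadraticTwist
import Literature.Combinatorics.Designs.GoethalsSeidelArray

/-!
# Paley's conference matrices `C(p + 1)` for every odd prime `p` (kernel) — the structural `(+)` control family of row F11

Framing: lottery ticket; floor = certified bounds/negative ranges.  Cell pub-namedobj (venture DiscreteObjects), target (H),
hadamard gen 27.  PRINT STATUS: Paley 1933 (Seberry–Yamada 2020 §1 / Brouwer–Haemers §10.4, 'the following construction, where
`n − 1` is an odd prime power, is due to Paley'); the kernel proof is ours and reuses the tree's Jacobsthal sum
`Literature.NumberTheory.LFunctions.sum_quadraticChar_mul_sub_eq_neg_one` (KloostermanQuadraticTwist) (`Σ_y χ(y(y − t)) = −1`, `t ≠ 0`).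
For an odd prime `p` let `χ` be the quadratic character of `ZMod p` and `C` the matrix on `Option (ZMod p)` with `C(∞,∞) = 0`,
`C(∞,x) = C(x,∞) = 1`, `C(x,y) = χ(y − x)`.  Then (`paley_conference`): `C` has zero diagonal, `±1` off the diagonal and
`C Cᵀ = p·I` — a CONFERENCE MATRIX OF ORDER `p + 1` for every odd prime `p` (symmetric when `χ(−1) = 1`, i.e. `p ≡ 1 (mod 4)`:
`paley_conference_symm`).  Ingredients: `jacobsthal_row` (`Σ_y χ(y − x) = 0`), `jacobsthal_gram` (`Σ_z χ(z − x) χ(z − y) =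
(p − 1)[x = y] − [x ≠ y]`).  With gen 27's `conference_double_isHadamard` (ConferenceRoute668) this gives Paley's Hadamard matrices
of order `2(p + 1)` in the kernel; and it is the infinite family of `(+)` controls for the census rows F11/F11′ (the objects
excluded at `334 = 333 + 1`, `333 = 3²·37` not a prime, exist at every `p + 1`).  §2 (appended): **`paley_hadamard_I`** — for `χ(−1) = −1`
(`p ≡ 3 (mod 4)`) the bordered matrix `I + [[0, 𝟙ᵀ], [−𝟙, Q]]` is a SKEW Hadamard matrix of order `p + 1` (Paley's first family;
at `p = 167`: the skew `H(168)`).  Prime powers are not treated (the tree's Jacobsthal lemma is stated over `ZMod p`).  Ours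
(formalisation); no `sorry`.
-/

namespace Summit.Ventures.DiscreteObjects.Hadamard

open Finset BigOperators Matrix

variable {p : ℕ} [hp : Fact p.Prime]

/-- row sums of the Jacobsthal matrix vanish: `Σ_y χ(y − x) = 0`. -/
theorem jacobsthal_row (hp2 : p ≠ 2) (x : ZMod p) : ∑ y : ZMod p, (quadraticChar (ZMod p) (y - x) : ℤ) = 0 := by
  have hF : ringChar (ZMod p) ≠ 2 := by rwa [ZMod.ringChar_zmod_n]
  rw [show ∑ y : ZMod p, (quadraticChar (ZMod p) (y - x) : ℤ) = ∑ y : ZMod p, (quadraticChar (ZMod p) y : ℤ) from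
    Fintype.sum_equiv (Equiv.subRight x) _ _ (fun y => rfl)]
  exact quadraticChar_sum_zero hF

/-- values of the Jacobsthal matrix: `0` on the diagonal, `±1` off it. -/
theorem jacobsthal_entry (x y : ZMod p) :
    (x = y → (quadraticChar (ZMod p) (y - x) : ℤ) = 0) ∧
    (x ≠ y → (quadraticChar (ZMod p) (y - x) : ℤ) = 1 ∨ (quadraticChar (ZMod p) (y - x) : ℤ) = -1) := by
  constructor
  · intro h; rw [h, sub_self, quadraticChar_zero]
  · intro h
    exact quadraticChar_dichotomy (sub_ne_zero.mpr (Ne.symm h))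

/-- **Gram identity of the Jacobsthal matrix**: `Σ_z χ(z − x) χ(z − y) = p − 1` if `x = y` and `−1` otherwise (Jacobsthal's sum). -/
theorem jacobsthal_gram (hp2 : p ≠ 2) (x y : ZMod p) :
    ∑ z : ZMod p, (quadraticChar (ZMod p) (z - x) : ℤ) * (quadraticChar (ZMod p) (z - y) : ℤ) =
      if x = y then (p : ℤ) - 1 else -1 := by
  by_cases hxy : x = y
  · subst hxy
    rw [if_pos rfl]
    have e : ∀ z : ZMod p, (quadraticChar (ZMod p) (z - x) : ℤ) * (quadraticChar (ZMod p) (z - x) : ℤ) =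
        1 - (if z = x then 1 else 0) := by
      intro z
      by_cases hz : z = x
      · rw [hz, sub_self, quadraticChar_zero, if_pos rfl]; norm_num
      · rw [if_neg hz, ← sq, quadraticChar_sq_one (sub_ne_zero.mpr hz)]; norm_num
    rw [Finset.sum_congr rfl (fun z _ => e z), Finset.sum_sub_distrib, Finset.sum_const, Finset.card_univ, ZMod.card,
      Finset.sum_ite_eq' Finset.univ x, if_pos (Finset.mem_univ _)]
    simp
  · rw [if_neg hxy]
    -- substitute `w = z − y`: `Σ_w χ(w − (x − y)) χ(w) = Σ_w χ(w (w − t))`, `t = x − y ≠ 0`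
    have ht : x - y ≠ 0 := sub_ne_zero.mpr hxy
    have e1 : ∑ z : ZMod p, (quadraticChar (ZMod p) (z - x) : ℤ) * (quadraticChar (ZMod p) (z - y) : ℤ) =
        ∑ w : ZMod p, (quadraticChar (ZMod p) (w * (w - (x - y))) : ℤ) := by
      rw [← Fintype.sum_equiv (Equiv.subRight y) (fun z => (quadraticChar (ZMod p) (z - x) : ℤ) *
        (quadraticChar (ZMod p) (z - y) : ℤ)) (fun w => (quadraticChar (ZMod p) (w * (w - (x - y))) : ℤ))]
      intro z
      simp only [Equiv.subRight_apply]
      rw [map_mul, mul_comm]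
      congr 2; ring
    rw [e1]
    have h := Literature.NumberTheory.LFunctions.sum_quadraticChar_mul_sub_eq_neg_one (p := p) hp2 ht
    exact_mod_cast h

/-- **Paley's conference matrix of order `p + 1`** (`p` an odd prime): the bordered Jacobsthal matrix on `Option (ZMod p)` has zero
diagonal, `±1` off the diagonal and `C Cᵀ = p·I = (|Option (ZMod p)| − 1)·I`. -/
theorem paley_conference (hp2 : p ≠ 2) :
    let C : Matrix (Option (ZMod p)) (Option (ZMod p)) ℤ := Matrix.of fun a b => Option.elim a (Option.elim b 0 (fun _ => 1))
      (fun x => Option.elim b 1 (fun y => (quadraticChar (ZMod p) (y - x) : ℤ)))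
    (∀ a, C a a = 0) ∧ (∀ a b, a ≠ b → C a b = 1 ∨ C a b = -1) ∧
      C * Cᵀ = ((Fintype.card (Option (ZMod p)) : ℤ) - 1) • (1 : Matrix (Option (ZMod p)) (Option (ZMod p)) ℤ) ∧
      Fintype.card (Option (ZMod p)) = p + 1 := by
  intro C
  have hCnn : C none none = 0 := rfl
  have hCns : ∀ y, C none (some y) = 1 := fun _ => rfl
  have hCsn : ∀ x, C (some x) none = 1 := fun _ => rfl
  have hCss : ∀ x y, C (some x) (some y) = (quadraticChar (ZMod p) (y - x) : ℤ) := fun _ _ => rfl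
  have hcard : Fintype.card (Option (ZMod p)) = p + 1 := by rw [Fintype.card_option, ZMod.card]
  refine ⟨?_, ?_, ?_, hcard⟩
  · rintro (_ | x)
    · rfl
    · rw [hCss]; exact (jacobsthal_entry x x).1 rfl
  · rintro (_ | x) (_ | y) hab
    · exact absurd rfl hab
    · left; rfl
    · left; rfl
    · rw [hCss]; exact (jacobsthal_entry x y).2 (fun h => hab (by rw [h]))
  · ext a b
    rw [Matrix.mul_apply, Fintype.sum_option, Matrix.smul_apply, Matrix.one_apply, smul_eq_mul, hcard]
    simp only [Matrix.transpose_apply]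
    push_cast
    rcases a with _ | x <;> rcases b with _ | y
    · simp [hCnn, hCns]
    · simp only [hCnn, hCns, hCss, zero_mul, zero_add, one_mul]
      rw [jacobsthal_row hp2 y]; simp
    · simp only [hCnn, hCns, hCsn, hCss, mul_zero, zero_add, mul_one]
      rw [jacobsthal_row hp2 x]; simp
    · simp only [hCsn, hCss, mul_one, Option.some.injEq]
      rw [jacobsthal_gram hp2 x y]
      split_ifs <;> ring

/-- for `χ(−1) = 1` (i.e. `p ≡ 1 (mod 4)`) the Paley conference matrix is SYMMETRIC. -/
theorem paley_conference_symm (hm1 : quadraticChar (ZMod p) (-1) = 1) :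
    let C : Matrix (Option (ZMod p)) (Option (ZMod p)) ℤ := Matrix.of fun a b => Option.elim a (Option.elim b 0 (fun _ => 1))
      (fun x => Option.elim b 1 (fun y => (quadraticChar (ZMod p) (y - x) : ℤ)))
    Cᵀ = C := by
  intro C
  ext a b
  rw [Matrix.transpose_apply]
  rcases a with _ | x <;> rcases b with _ | y
  · rfl
  · rfl
  · rfl
  · show (quadraticChar (ZMod p) (x - y) : ℤ) = (quadraticChar (ZMod p) (y - x) : ℤ)
    rw [show x - y = (-1) * (y - x) by ring, map_mul, hm1, one_mul]

/-! ## §2 (appended) Paley's first family: SKEW Hadamard matrices of order `p + 1` for `p ≡ 3 (mod 4)` -/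

/-- **Paley I** (`χ(−1) = −1`, i.e. `p ≡ 3 (mod 4)`): the matrix `H` on `Option (ZMod p)` with `H(∞,∞) = 1`, `H(∞,x) = 1`,
`H(x,∞) = −1`, `H(x,y) = χ(y − x) + [x = y]` is a SKEW Hadamard matrix of order `p + 1` (`H Hᵀ = (p+1) I`, `H + Hᵀ = 2 I`).
At `p = 167` this is the skew `H(168)` whose core is the cell's `paley167`. -/
theorem paley_hadamard_I (hp2 : p ≠ 2) (hm1 : quadraticChar (ZMod p) (-1) = -1) :
    let H : Matrix (Option (ZMod p)) (Option (ZMod p)) ℤ := Matrix.of fun a b => Option.elim a (Option.elim b 1 (fun _ => 1))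
      (fun x => Option.elim b (-1) (fun y => (quadraticChar (ZMod p) (y - x) : ℤ) + (if x = y then 1 else 0)))
    Literature.Combinatorics.Designs.GoethalsSeidel.IsHadamardMatrix H ∧
      H + Hᵀ = (2 : ℤ) • (1 : Matrix (Option (ZMod p)) (Option (ZMod p)) ℤ) ∧ Fintype.card (Option (ZMod p)) = p + 1 := by
  intro H
  have hHnn : H none none = 1 := rfl
  have hHns : ∀ y, H none (some y) = 1 := fun _ => rfl
  have hHsn : ∀ x, H (some x) none = -1 := fun _ => rfl
  have hHss : ∀ x y, H (some x) (some y) = (quadraticChar (ZMod p) (y - x) : ℤ) + (if x = y then 1 else 0) := fun _ _ => rfl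
  have hcard : Fintype.card (Option (ZMod p)) = p + 1 := by rw [Fintype.card_option, ZMod.card]
  have hskew : ∀ x y : ZMod p, (quadraticChar (ZMod p) (x - y) : ℤ) = -(quadraticChar (ZMod p) (y - x) : ℤ) := by
    intro x y
    rw [show x - y = (-1) * (y - x) by ring, map_mul, hm1]; ring
  refine ⟨⟨?_, ?_⟩, ?_, hcard⟩
  · rintro (_ | x) (_ | y)
    · left; rfl
    · left; rfl
    · right; rfl
    · rw [hHss]
      by_cases hxy : x = y
      · left; rw [if_pos hxy, hxy, sub_self, quadraticChar_zero]; norm_num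
      · rw [if_neg hxy, add_zero]; exact (jacobsthal_entry x y).2 hxy
  · ext a b
    rw [Matrix.mul_apply, Fintype.sum_option, Matrix.smul_apply, Matrix.one_apply, smul_eq_mul, hcard]
    simp only [Matrix.transpose_apply]
    push_cast
    rcases a with _ | x <;> rcases b with _ | y
    · simp [hHnn, hHns, add_comm]
    · simp only [hHnn, hHns, hHsn, hHss, one_mul, mul_neg, mul_one]
      rw [Finset.sum_add_distrib, jacobsthal_row hp2 y, Finset.sum_ite_eq Finset.univ y]; simp
    · simp only [hHnn, hHns, hHsn, hHss, mul_one]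
      rw [Finset.sum_add_distrib, jacobsthal_row hp2 x, Finset.sum_ite_eq Finset.univ x]; simp
    · simp only [hHsn, hHss, Option.some.injEq]
      by_cases hxy : x = y
      · subst hxy
        rw [if_pos rfl]
        have e2 : ∀ z : ZMod p, ((quadraticChar (ZMod p) (z - x) : ℤ) + (if x = z then 1 else 0)) *
            ((quadraticChar (ZMod p) (z - x) : ℤ) + (if x = z then 1 else 0)) =
            (quadraticChar (ZMod p) (z - x) : ℤ) * (quadraticChar (ZMod p) (z - x) : ℤ) + (if x = z then 1 else 0) := by
          intro z
          by_cases hz : x = z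
          · rw [if_pos hz, ← hz, sub_self, quadraticChar_zero]; norm_num
          · rw [if_neg hz]; ring
        rw [Finset.sum_congr rfl (fun z _ => e2 z), Finset.sum_add_distrib, jacobsthal_gram hp2 x x, if_pos rfl,
          Finset.sum_ite_eq Finset.univ x, if_pos (Finset.mem_univ _)]
        ring
      · rw [if_neg hxy]
        have e : ∀ z : ZMod p, ((quadraticChar (ZMod p) (z - x) : ℤ) + (if x = z then 1 else 0)) *
            ((quadraticChar (ZMod p) (z - y) : ℤ) + (if y = z then 1 else 0)) =
            (quadraticChar (ZMod p) (z - x) : ℤ) * (quadraticChar (ZMod p) (z - y) : ℤ) +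
            (if y = z then (quadraticChar (ZMod p) (z - x) : ℤ) else 0) + (if x = z then (quadraticChar (ZMod p) (z - y) : ℤ) else 0) +
            (if x = z then (if y = z then 1 else 0) else 0) := by
          intro z; split_ifs <;> ring
        rw [Finset.sum_congr rfl (fun z _ => e z), Finset.sum_add_distrib, Finset.sum_add_distrib, Finset.sum_add_distrib,
          jacobsthal_gram hp2 x y, if_neg hxy, Finset.sum_ite_eq Finset.univ y, Finset.sum_ite_eq Finset.univ x,
          Finset.sum_ite_eq Finset.univ x, if_pos (Finset.mem_univ _), if_pos (Finset.mem_univ _), if_pos (Finset.mem_univ _),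
          if_neg (Ne.symm hxy), hskew x y]
        ring
  · ext a b
    rw [Matrix.add_apply, Matrix.transpose_apply, Matrix.smul_apply, Matrix.one_apply, smul_eq_mul]
    rcases a with _ | x <;> rcases b with _ | y
    · simp [hHnn]
    · simp [hHns, hHsn]
    · simp [hHns, hHsn]
    · simp only [hHss, Option.some.injEq]
      by_cases hxy : x = y
      · subst hxy
        simp
      · simp [hxy, Ne.symm hxy, hskew x y]

end Summit.Ventures.DiscreteObjects.Hadamard
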